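/-
Copyright (c) 2026 the pub-hodgecm-mathlib formalisation cell (harness21).  Prover seat hodgecm-mathlib-F0P2-p02 (g11): road «S3-tree», the LIFT `_le_one ↦ _le_two`, organ (I)
`stub_liftInterior` split A-139 (architect A-p16 (g30)): N1 `shifted_binders_of_typeOne` + N4 `not_levi_of_shift`, 2026-09-01.
-/
import Literature.NumberTheory.Rogawski1990.TypeTwoCayleyShiftBindersCM   -- ★ γ₃ F0P2-p06 (g10): `separable_of_map_evalRingHom`, `isUnit_shift_denominators_of_typeTwo` (the type-(2) template); brings ★ γ₁ γ₂ α β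
import Literature.NumberTheory.Automorphic.MatrixMoebiusShiftInverse           -- ★ p846466 (this seat): `moebius_neg_moebius`, `isUnit_det_neg_smul_moebius_add_smul_one`, `det_smul_conj_add_smul_one`
import HarnessLib

/-!
# The Cayley shift at a CM place, TYPE (1) and type-free: unit denominators under a discriminant-depth hypothesis, the shifted roots
# `α ↦ φ_c(α)` at depth `N − 1`, `G`-regularity of the shift, and «non-Levi is preserved» (Rogawski 1990 §4.9 Prop. 4.9.1; Kottwitz 1986 §3)

Topic `NumberTheory/Rogawski1990`; namespace `Literature.NumberTheory.Rogawski1990`.  THEOREMS ONLY (no definition, no instance, no notation, no named fact, no `sorry`);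
kernel lane `--supports stmt-HodgeConjecture-24833`.  Cell `pub/hodgecm-mathlib` (D-0151), crux H413; road «S3-tree», the LIFT `_le_one ↦ _le_two`, organ (I)
`stub_liftInterior` of the fold `LocalTransferAtOneHyperspecialLevelTwo` v3.2 :482 (architect A-p16 (g30) A-139: «(I) SPLIT INTO THREE PARALLEL M's» — this file is
N1 + N4; N3 = F0P2-p01 (g14); N6 = the assembly).  Companion of ★ γ₃ `TypeTwoCayleyShiftBindersCM` (F0P2-p06 (g10)), whose §2 is the template of §2 here.
HONEST LABEL: HC_CM is proved only modulo the 2 remaining named inputs (hLiu418 24832, h413 24833) until rung 0 closes; nothing printed is asserted here.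

THE MATHEMATICS.  `w ∣ v` non-split unramified, `c ∈ E_v` with `σ(c) = c`, `|c_w| = exp(−1)`, `|2|_w = 1`; `φ_c(M) = ((c+1)M + (c−1))((c−1)M + (c+1))⁻¹`, on scalars
`φ_c(x) = ((c+1)x + (c−1)) ∕ ((c−1)x + (c+1))`.  §1 (scalars, any valued field): `φ_c(x) − φ_c(y) = 4c(x − y) ∕ (D_x D_y)`, `φ_c(x) − 1 = 2(x − 1) ∕ D_x` with `D_x = (c−1)x + (c+1)
= 2c + (c−1)(x−1)`, so for `|x − 1| ≤ exp(−2)`: `|D_x| = exp(−1)`, `|φ_c x − φ_c y| = q·|x − y|`, `|φ_c x − 1| < 1`.  §2 (type-free twin of ★ γ₃ §2): for `γ_H = (g, u)` DEEP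
(`g_w ≡ 1`, `u_w ≡ 1 (mod c_w)` entrywise) with `|disc χ_{g_w}|_w < exp(−2)` (type (2): `exp(−(2N+1))`, `N ≥ 1`; type (1): `exp(−2N)`, `N ≥ 2`) the eleven denominator facts of ★
`isUnit_shift_denominators_of_typeTwo` hold — the odd-valuation binder was used there only to make `χ̄_{X₂}`'s discriminant residually small.  §3 TYPE (1): if `χ_{g_w}` has the two
roots `α ≠ γ`, `|α − γ| = exp(−N)`, `N ≥ 2`, `|α − 1|, |γ − 1| ≤ exp(−2)`, and `γ_H′ = (φ_c g, φ_c u)` on matrices, then `χ_{g′_w}` has the roots `φ_{c_w} α ≠ φ_{c_w} γ` at depth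
`N − 1`, both `≡ 1`, `|χ_{g′}(u′)|_w = exp(−(n−2))` (★ γ₁, type-free), and `γ_H′` is `G`-regular — the binders of ★ `stableOrbitalIntegralRel_chi_shift_of_isRoot` (END p846474) and of
★ (A3) `finsum_finExplicitDelta_mul_eq_inv_sq_mul_finsum_shift` (p846531) at `u_H = γ_H′`.  §4 «NON-LEVI IS PRESERVED»: if `γ_H′.1` is `H_v`-conjugate to a diagonal then so is
`γ_H.1 = ψ(γ_H′.1)` (`ψ = φ_{c+1, −(c−1)}`, ★ `moebius_neg_moebius`, ★ α `moebius_conj`; a Möbius of a diagonal is diagonal).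

## References
* [Rogawski1990] J. D. Rogawski, *Automorphic Representations of Unitary Groups in Three Variables*, Ann. of Math. Stud. 123 (1990), §4.9 Prop. 4.9.1 (a)(b) p. 55; §4.3 p. 42.
* [Kottwitz1986] R. E. Kottwitz, *Base change for unit elements of Hecke algebras*, Compositio Math. 60 (1986), §3.
* [Flicker1998UnitaryFL] Y. Z. Flicker, *Elementary proof of the fundamental lemma for a unitary group*, Canad. J. Math. 50 (1998), §6.
* [SerreLocalFields1979] J.-P. Serre, *Local Fields*, GTM 67 (1979), Ch. I §§1–2 (discrete valuations), Ch. II §2.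
-/

set_option autoImplicit false

noncomputable section

open NumberField IsDedekindDomain Matrix Polynomial
open scoped MatrixGroups WithZero

/-! ## §1 Scalars: the Möbius shift on roots, in a valued field -/

namespace Literature.NumberTheory.Automorphic.MoebiusShift

section Scalar

variable {K : Type*} [Field K] [Valued K ℤᵐ⁰]

omit [Valued K ℤᵐ⁰] in
/-- `φ(x) − φ(y) = (a² − b²)(x − y) ∕ ((bx + a)(by + a))` for the scalar Möbius map `φ(x) = (ax + b)∕(bx + a)`. [cite: Kottwitz1986, §3] -/
theorem moebius_scalar_sub_moebius_scalar (a b x y : K) (hx : b * x + a ≠ 0) (hy : b * y + a ≠ 0) :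
    (a * x + b) / (b * x + a) - (a * y + b) / (b * y + a) = (a ^ 2 - b ^ 2) * (x - y) / ((b * x + a) * (b * y + a)) := by
  rw [div_sub_div _ _ hx hy]
  congr 1
  ring

omit [Valued K ℤᵐ⁰] in
/-- `φ(x) − 1 = (a − b)(x − 1) ∕ (bx + a)`. [cite: Kottwitz1986, §3] -/
theorem moebius_scalar_sub_one (a b x : K) (hx : b * x + a ≠ 0) :
    (a * x + b) / (b * x + a) - 1 = (a - b) * (x - 1) / (b * x + a) := by
  rw [div_sub_one hx]
  congr 1
  ring

/-- **The scalar denominators at a `2`-deep point**: `|x − 1| ≤ exp(−2)`, `|c| = exp(−1)`, `|2| = 1` ⇒ `|(c−1)x + (c+1)| = exp(−1) = |(c+1)x + (c−1)|`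
(`(c∓1)x + (c±1) = 2c + (c∓1)(x − 1)`). [cite: Kottwitz1986, §3] [cite: SerreLocalFields1979, Ch. I §§1–2] -/
theorem valued_shift_denominators_of_deep (h2 : Valued.v (2 : K) = 1) {c : K} (hc : Valued.v c = WithZero.exp (-1 : ℤ)) {x : K}
    (hx : Valued.v (x - 1) ≤ WithZero.exp (-2 : ℤ)) :
    Valued.v ((c - 1) * x + (c + 1)) = WithZero.exp (-1 : ℤ) ∧ Valued.v ((c + 1) * x + (c - 1)) = WithZero.exp (-1 : ℤ) := by
  obtain ⟨-, -, hcm, hcp, -, -⟩ := shift_parameter_facts hc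
  have h2c : Valued.v (2 * c) = WithZero.exp (-1 : ℤ) := by rw [map_mul, h2, one_mul, hc]
  have hlt : WithZero.exp (-2 : ℤ) < WithZero.exp (-1 : ℤ) := by rw [WithZero.exp_lt_exp]; norm_num
  have e1 : (c - 1) * x + (c + 1) = 2 * c + (c - 1) * (x - 1) := by ring
  have e2 : (c + 1) * x + (c - 1) = 2 * c + (c + 1) * (x - 1) := by ring
  have l1 : Valued.v ((c - 1) * (x - 1)) < Valued.v (2 * c) := by
    rw [map_mul, hcm, one_mul, h2c]; exact lt_of_le_of_lt hx hlt
  have l2 : Valued.v ((c + 1) * (x - 1)) < Valued.v (2 * c) := by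
    rw [map_mul, hcp, one_mul, h2c]; exact lt_of_le_of_lt hx hlt
  exact ⟨by rw [e1, Valuation.map_add_eq_of_lt_left _ l1, h2c], by rw [e2, Valuation.map_add_eq_of_lt_left _ l2, h2c]⟩

/-- **`|φ_c x − φ_c y| = q·|x − y|`** for `2`-deep `x, y` (`φ_c x − φ_c y = 4c(x−y)∕(D_x D_y)`, `|4c| = exp(−1)`, `|D_x| = |D_y| = exp(−1)`).
[cite: Kottwitz1986, §3] [cite: Rogawski1990, §4.9 Prop. 4.9.1 (b) p. 55] -/
theorem valued_moebius_scalar_sub (h2 : Valued.v (2 : K) = 1) {c : K} (hc : Valued.v c = WithZero.exp (-1 : ℤ)) {x y : K}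
    (hx : Valued.v (x - 1) ≤ WithZero.exp (-2 : ℤ)) (hy : Valued.v (y - 1) ≤ WithZero.exp (-2 : ℤ)) :
    Valued.v (((c + 1) * x + (c - 1)) / ((c - 1) * x + (c + 1)) - ((c + 1) * y + (c - 1)) / ((c - 1) * y + (c + 1))) =
      Valued.v (x - y) * WithZero.exp (1 : ℤ) := by
  obtain ⟨hDx, -⟩ := valued_shift_denominators_of_deep h2 hc hx
  obtain ⟨hDy, -⟩ := valued_shift_denominators_of_deep h2 hc hy
  have hDx0 : (c - 1) * x + (c + 1) ≠ 0 := fun h => by rw [h, map_zero] at hDx; exact WithZero.zero_ne_coe hDx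
  have hDy0 : (c - 1) * y + (c + 1) ≠ 0 := fun h => by rw [h, map_zero] at hDy; exact WithZero.zero_ne_coe hDy
  have h4c : Valued.v ((c + 1) ^ 2 - (c - 1) ^ 2) = WithZero.exp (-1 : ℤ) := by
    rw [show (c + 1) ^ 2 - (c - 1) ^ 2 = 2 * 2 * c by ring, map_mul, map_mul, h2, hc, one_mul, one_mul]
  rw [moebius_scalar_sub_moebius_scalar _ _ _ _ hDx0 hDy0, map_div₀, map_mul, map_mul, h4c, hDx, hDy, ← WithZero.exp_add,
    div_eq_iff (WithZero.exp_ne_zero), mul_comm (WithZero.exp (-1 : ℤ)) (Valued.v (x - y)), mul_assoc, ← WithZero.exp_add]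
  norm_num

/-- **`|φ_c x − 1| < 1`** for `2`-deep `x` (`φ_c x − 1 = 2(x−1)∕D_x`, so `|φ_c x − 1| = q·|x − 1| ≤ exp(−1)`). [cite: Kottwitz1986, §3] -/
theorem valued_moebius_scalar_sub_one_lt_one (h2 : Valued.v (2 : K) = 1) {c : K} (hc : Valued.v c = WithZero.exp (-1 : ℤ)) {x : K}
    (hx : Valued.v (x - 1) ≤ WithZero.exp (-2 : ℤ)) :
    Valued.v (((c + 1) * x + (c - 1)) / ((c - 1) * x + (c + 1)) - 1) < 1 := by
  obtain ⟨hDx, -⟩ := valued_shift_denominators_of_deep h2 hc hx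
  have hDx0 : (c - 1) * x + (c + 1) ≠ 0 := fun h => by rw [h, map_zero] at hDx; exact WithZero.zero_ne_coe hDx
  rw [moebius_scalar_sub_one _ _ _ hDx0, map_div₀, map_mul, show (c + 1) - (c - 1) = (2 : K) by ring, h2, one_mul, hDx, div_eq_mul_inv,
    ← WithZero.exp_neg, neg_neg]
  calc Valued.v (x - 1) * WithZero.exp (1 : ℤ) ≤ WithZero.exp (-2 : ℤ) * WithZero.exp (1 : ℤ) := mul_le_mul_left hx _
    _ < 1 := by rw [← WithZero.exp_add, ← WithZero.exp_zero, WithZero.exp_lt_exp]; norm_num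

omit [Valued K ℤᵐ⁰] in
/-- **Roots shift with the matrix**: if `χ_g(x) = 0` (`2 × 2`), `det((b•g + a•1)) ≠ 0`, `bx + a ≠ 0`, then `χ_{φ(g)}(φ(x)) = 0` (★ α `eval_charpoly_moebius_fin_two`).
[cite: Kottwitz1986, §3] [cite: Rogawski1990, §4.9 Prop. 4.9.1 (b) p. 55] -/
theorem isRoot_charpoly_moebius_of_isRoot (g : Matrix (Fin 2) (Fin 2) K) (a b x : K) (hD : (b • g + a • (1 : Matrix (Fin 2) (Fin 2) K)).det ≠ 0) (hx : b * x + a ≠ 0)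
    (hr : g.charpoly.IsRoot x) :
    ((a • g + b • (1 : Matrix (Fin 2) (Fin 2) K)) * (b • g + a • (1 : Matrix (Fin 2) (Fin 2) K))⁻¹).charpoly.IsRoot ((a * x + b) / (b * x + a)) := by
  have key := eval_charpoly_moebius_fin_two g a b x hD hx
  rw [hr.eq_zero, mul_zero] at key
  rcases mul_eq_zero.1 key with h | h
  · rcases mul_eq_zero.1 h with h' | h'
    · exact h'
    · exact absurd ((pow_eq_zero_iff two_ne_zero).1 h') hx
  · exact absurd h hD

omit [Valued K ℤᵐ⁰] in
/-- **Two distinct roots pin a `2 × 2` characteristic polynomial**: `χ_g(α) = χ_g(γ) = 0`, `α ≠ γ` ⇒ `tr g = α + γ`, `det g = αγ`, `disc χ_g = (α − γ)²`.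
[cite: SerreLocalFields1979, Ch. I §§1–2] -/
theorem trace_det_disc_of_isRoot_of_isRoot (g : Matrix (Fin 2) (Fin 2) K) {α γ : K} (hα : g.charpoly.IsRoot α) (hγ : g.charpoly.IsRoot γ) (hαγ : α ≠ γ) :
    g.trace = α + γ ∧ g.det = α * γ ∧ g.trace ^ 2 - 4 * g.det = (α - γ) ^ 2 := by
  have e : ∀ z : K, g.charpoly.eval z = z ^ 2 - g.trace * z + g.det := fun z => by
    rw [Matrix.charpoly_fin_two, Matrix.trace_fin_two]; simp
  have hα' : α ^ 2 - g.trace * α + g.det = 0 := by rw [← e]; exact hα.eq_zero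
  have hγ' : γ ^ 2 - g.trace * γ + g.det = 0 := by rw [← e]; exact hγ.eq_zero
  have hsub : (α - γ) * (α + γ - g.trace) = 0 := by linear_combination hα' - hγ'
  have htr : g.trace = α + γ := by
    have h := (mul_eq_zero.1 hsub).resolve_left (sub_ne_zero.2 hαγ)
    linear_combination -h
  have hdet : g.det = α * γ := by rw [htr] at hα'; linear_combination hα'
  exact ⟨htr, hdet, by rw [htr, hdet]; ring⟩

end Scalar

end Literature.NumberTheory.Automorphic.MoebiusShift

namespace Literature.NumberTheory.Rogawski1990

open Literature.NumberTheory.Automorphic Literature.NumberTheory.Automorphic.UnitaryGroup Literature.NumberTheory.Automorphic.MoebiusShift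
open Literature.NumberTheory.GaloisRepresentations Literature.NumberTheory.NumberFields

variable (L : Type) [Field L] [NumberField L] [IsCMField L] (v : HeightOneSpectrum (𝓞 ↥(maximalRealSubfield L)))
  (w : PlacesOver L v) (hw : IsCMField.complexConj L • w.1 = w.1)

/-! ## §2 Type-free: the Möbius denominators of a deep `γ_H` are units, under `|disc χ_{g_w}|_w < exp(−2)` -/

include hw in
set_option maxHeartbeats 400000 in
-- the carriers' types are large
/-- **THE DENOMINATORS ARE UNITS — TYPE-FREE** (twin of ★ `isUnit_shift_denominators_of_typeTwo` with the odd-valuation binder replaced by `|disc χ_{g_w}|_w < exp(−2)`,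
which is all its proof used: it makes `χ̄_{X₂}`'s discriminant residually nilpotent, `X₂ = c⁻¹(g − 1)`): for a deep `γ_H = (g, u)` at a non-split unramified `w`,
`det((c−1)g + (c+1))`, `det((c+1)g + (c−1))`, `(c−1)u + (c+1)`, `(c+1)u + (c−1)` and `det((c−1)ι(γ_H) + (c+1))` are units of `E_v`, with `w`-valuations `exp(−2), exp(−2),
exp(−1), exp(−1)` for the first four. [cite: Kottwitz1986, §3] [cite: Rogawski1990, §4.9 Prop. 4.9.1 (b) p. 55] -/
theorem isUnit_shift_denominators_of_disc_lt
    (γH : (cmDatum L 2 (Matrix.of fun i j : Fin 2 => if i.val + j.val + 1 = 2 then (1 : L) else 0)).Local v ×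
      (cmDatum L 1 (Matrix.of fun i j : Fin 1 => if i.val + j.val + 1 = 1 then (1 : L) else 0)).Local v)
    {c : LocalRing L v} (hσc : conjLocal L (IsCMField.complexConj L) v c = c) (hc : Valued.v (c w) = WithZero.exp (-1 : ℤ))
    (h2 : Valued.v (2 : w.1.adicCompletion L) = 1)
    (hg1 : ∀ i j, Valued.v ((((γH.1.val : GL (Fin 2) (LocalRing L v)).val.map (Pi.evalRingHom (fun w' : PlacesOver L v => w'.1.adicCompletion L) w)) - 1) i j) ≤ Valued.v (c w))
    (hu1 : Valued.v (finGammaTwo L v γH w - 1) ≤ Valued.v (c w))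
    (hdisc : Valued.v (((γH.1.val : GL (Fin 2) (LocalRing L v)).val.map
        (Pi.evalRingHom (fun w' : PlacesOver L v => w'.1.adicCompletion L) w)).trace ^ 2 -
      4 * ((γH.1.val : GL (Fin 2) (LocalRing L v)).val.map
        (Pi.evalRingHom (fun w' : PlacesOver L v => w'.1.adicCompletion L) w)).det) < WithZero.exp (-2 : ℤ)) :
    Valued.v ((((c - 1) • ((γH.1.val : GL (Fin 2) (LocalRing L v)).val : Matrix (Fin 2) (Fin 2) (LocalRing L v)) + (c + 1) • (1 : Matrix (Fin 2) (Fin 2) (LocalRing L v))).det) w) =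
        WithZero.exp (-2 : ℤ) ∧
      Valued.v ((((c + 1) • ((γH.1.val : GL (Fin 2) (LocalRing L v)).val : Matrix (Fin 2) (Fin 2) (LocalRing L v)) + (c - 1) • (1 : Matrix (Fin 2) (Fin 2) (LocalRing L v))).det) w) =
        WithZero.exp (-2 : ℤ) ∧
      Valued.v (((c - 1) * finGammaTwo L v γH + (c + 1)) w) = WithZero.exp (-1 : ℤ) ∧
      Valued.v (((c + 1) * finGammaTwo L v γH + (c - 1)) w) = WithZero.exp (-1 : ℤ) ∧
      IsUnit ((((c - 1) • ((γH.1.val : GL (Fin 2) (LocalRing L v)).val : Matrix (Fin 2) (Fin 2) (LocalRing L v)) + (c + 1) • (1 : Matrix (Fin 2) (Fin 2) (LocalRing L v))).det)) ∧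
      IsUnit ((((c + 1) • ((γH.1.val : GL (Fin 2) (LocalRing L v)).val : Matrix (Fin 2) (Fin 2) (LocalRing L v)) + (c - 1) • (1 : Matrix (Fin 2) (Fin 2) (LocalRing L v))).det)) ∧
      IsUnit ((c - 1) * finGammaTwo L v γH + (c + 1)) ∧ IsUnit ((c + 1) * finGammaTwo L v γH + (c - 1)) ∧
      IsUnit ((((c - 1) • ((γH.2.val : GL (Fin 1) (LocalRing L v)).val : Matrix (Fin 1) (Fin 1) (LocalRing L v)) + (c + 1) • (1 : Matrix (Fin 1) (Fin 1) (LocalRing L v))).det)) ∧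
      IsUnit ((((c + 1) • ((γH.2.val : GL (Fin 1) (LocalRing L v)).val : Matrix (Fin 1) (Fin 1) (LocalRing L v)) + (c - 1) • (1 : Matrix (Fin 1) (Fin 1) (LocalRing L v))).det)) ∧
      IsUnit (((c - 1) • (((endoEmbLocal L v γH).val : GL (Fin 3) (LocalRing L v)).val : Matrix (Fin 3) (Fin 3) (LocalRing L v)) + (c + 1) • (1 : Matrix (Fin 3) (Fin 3) (LocalRing L v))).det) := by
  have hv : Subsingleton (PlacesOver L v) := PlacesOver.subsingleton_of_smul_eq (IsCMField.complexConj L) (IsCMField.complexConj_ne_one L) w hw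
  set evw : LocalRing L v →+* w.1.adicCompletion L := Pi.evalRingHom (fun w' : PlacesOver L v => w'.1.adicCompletion L) w with hevw
  set σw := galAdicCompletionMap (L := L) (IsCMField.complexConj L) hw with hσw
  set gw : Matrix (Fin 2) (Fin 2) (w.1.adicCompletion L) := ((γH.1.val : GL (Fin 2) (LocalRing L v)).val.map evw) with hgw
  set uw : w.1.adicCompletion L := finGammaTwo L v γH w with huw
  set cw : w.1.adicCompletion L := c w with hcw
  obtain ⟨hc0, hc1, hcm, hcp, hcm1, hcp1⟩ := shift_parameter_facts hc
  have hσ : ∀ x, Valued.v (σw x) = Valued.v x := fun x => valued_galAdicCompletionMap (L := L) (IsCMField.complexConj L) hw x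
  have hσcw : σw cw = cw := by
    have h := congrFun hσc w
    rw [conjLocal_apply_eq_of_smul_eq (IsCMField.complexConj L) (IsCMField.complexConj_ne_one L) v w hw] at h
    exact h
  -- the `U(Φ₂)`-coordinate: `g_w = 1 + c_w X`
  set X : Matrix (Fin 2) (Fin 2) (w.1.adicCompletion L) := cw⁻¹ • (gw - 1) with hX
  have hgX : gw = 1 + cw • X := eq_one_add_smul_inv_smul_sub_one hc0 gw
  have hXi : ∀ i j, Valued.v (X i j) ≤ 1 := forall_valued_inv_smul_sub_one_le_one hc0 hg1
  have hunit : (((1 : Matrix (Fin 2) (Fin 2) (w.1.adicCompletion L)) + cw • X).map σw)ᵀ * !![(0 : w.1.adicCompletion L), 1; 1, 0] * ((1 : Matrix (Fin 2) (Fin 2) _) + cw • X) =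
      !![(0 : w.1.adicCompletion L), 1; 1, 0] := by
    have h := transpose_map_fst_evalRingHom_mul L v w hw γH
    rw [placeForm_antidiagTwo_eq] at h
    rw [← hgX]
    exact h
  -- skewness from unitarity (★ β), residual smallness of the discriminant from `hdisc`
  have hskew : Valued.v (σw X.trace + X.trace) < 1 := by
    refine valued_map_trace_add_trace_lt_one_of_unitary σw hσ (J := !![(0 : w.1.adicCompletion L), 1; 1, 0]) (fun i j => ?_) ?_ hc0 hc1 hσcw hXi hunit
    · fin_cases i <;> fin_cases j <;> simp
    · simp [Matrix.det_fin_two]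
  have hdiscX : Valued.v (X.trace ^ 2 - 4 * X.det) < 1 := by
    have h := hdisc
    rw [hgX, trace_sq_sub_four_det_one_add_smul, map_mul, map_pow, hc, ← WithZero.exp_nsmul] at h
    have e2 : WithZero.exp ((2 : ℕ) • (-1 : ℤ)) = WithZero.exp (-2 : ℤ) := by norm_num
    rw [e2] at h
    have h' : WithZero.exp (-2 : ℤ) * Valued.v (X.trace ^ 2 - 4 * X.det) < WithZero.exp (-2 : ℤ) * 1 := by rwa [mul_one]
    exact lt_of_mul_lt_mul_left' h'
  obtain ⟨hm, hp⟩ := valued_det_two_smul_one_add_shift_smul_eq_one σw hσ h2 hc hXi hskew hdiscX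
  obtain ⟨hDm, hDp⟩ := valued_det_shift_denominators hc hm hp
  rw [← hgX] at hDm hDp
  -- the `U(Φ₁)`-coordinate: `u_w = 1 + c_w y`
  set y : w.1.adicCompletion L := cw⁻¹ * (uw - 1) with hy
  have huy : uw = 1 + cw * y := by rw [hy, ← mul_assoc, mul_inv_cancel₀ hc0, one_mul, add_sub_cancel]
  have hyi : Valued.v y ≤ 1 := valued_inv_mul_sub_one_le_one hc0 hu1
  have hnorm : σw (1 + cw * y) * (1 + cw * y) = 1 := by rw [← huy]; exact map_finGammaTwo_mul_finGammaTwo L v w hw γH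
  have hyskew := valued_map_add_lt_one_of_unitary_one σw hσ hc0 hc1 hσcw hyi hnorm
  obtain ⟨hym, hyp⟩ := valued_two_add_shift_mul_eq_one σw hσ h2 hc hyi hyskew
  obtain ⟨hum, hup⟩ := valued_shift_denominators_one hc hym hyp
  rw [← huy] at hum hup
  -- reading the `E_v`-elements at `w`
  have hdet2 : ∀ a b : LocalRing L v, ((a • ((γH.1.val : GL (Fin 2) (LocalRing L v)).val : Matrix (Fin 2) (Fin 2) (LocalRing L v)) + b • (1 : Matrix (Fin 2) (Fin 2) (LocalRing L v))).det) w =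
      (a w • gw + b w • (1 : Matrix (Fin 2) (Fin 2) (w.1.adicCompletion L))).det := fun a b => by
    have e1 : ((a • ((γH.1.val : GL (Fin 2) (LocalRing L v)).val : Matrix (Fin 2) (Fin 2) (LocalRing L v)) + b • (1 : Matrix (Fin 2) (Fin 2) (LocalRing L v))).det) w =
        evw ((a • ((γH.1.val : GL (Fin 2) (LocalRing L v)).val : Matrix (Fin 2) (Fin 2) (LocalRing L v)) + b • (1 : Matrix (Fin 2) (Fin 2) (LocalRing L v))).det) := rfl
    rw [e1, RingHom.map_det, RingHom.mapMatrix_apply, map_smul_add_smul_one]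
    rfl
  have hdet1 : ∀ a b : LocalRing L v, ((a • ((γH.2.val : GL (Fin 1) (LocalRing L v)).val : Matrix (Fin 1) (Fin 1) (LocalRing L v)) + b • (1 : Matrix (Fin 1) (Fin 1) (LocalRing L v))).det) w =
      a w * uw + b w := fun a b => by
    have e1 : ((a • ((γH.2.val : GL (Fin 1) (LocalRing L v)).val : Matrix (Fin 1) (Fin 1) (LocalRing L v)) + b • (1 : Matrix (Fin 1) (Fin 1) (LocalRing L v))).det) w =
        evw ((a • ((γH.2.val : GL (Fin 1) (LocalRing L v)).val : Matrix (Fin 1) (Fin 1) (LocalRing L v)) + b • (1 : Matrix (Fin 1) (Fin 1) (LocalRing L v))).det) := rfl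
    rw [e1, Matrix.det_fin_one]
    simp [evw, uw, finGammaTwo]
  have hsc : ∀ a b : LocalRing L v, ((a * finGammaTwo L v γH + b) w) = a w * uw + b w := fun a b => rfl
  have hw2m : Valued.v ((((c - 1) • ((γH.1.val : GL (Fin 2) (LocalRing L v)).val : Matrix (Fin 2) (Fin 2) (LocalRing L v)) + (c + 1) • (1 : Matrix (Fin 2) (Fin 2) (LocalRing L v))).det) w) =
      WithZero.exp (-2 : ℤ) := by rw [hdet2]; exact hDm
  have hw2p : Valued.v ((((c + 1) • ((γH.1.val : GL (Fin 2) (LocalRing L v)).val : Matrix (Fin 2) (Fin 2) (LocalRing L v)) + (c - 1) • (1 : Matrix (Fin 2) (Fin 2) (LocalRing L v))).det) w) =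
      WithZero.exp (-2 : ℤ) := by rw [hdet2]; exact hDp
  have hw1m : Valued.v (((c - 1) * finGammaTwo L v γH + (c + 1)) w) = WithZero.exp (-1 : ℤ) := by rw [hsc]; exact hum
  have hw1p : Valued.v (((c + 1) * finGammaTwo L v γH + (c - 1)) w) = WithZero.exp (-1 : ℤ) := by rw [hsc]; exact hup
  have hne : ∀ {x : LocalRing L v} {z : ℤ}, Valued.v (x w) = WithZero.exp z → IsUnit x := fun {x z} hx =>
    isUnit_localRing_of_ne_zero_of_subsingleton L v hv fun h0 => by rw [h0, Pi.zero_apply, map_zero] at hx; exact WithZero.zero_ne_coe hx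
  have hU2m := hne hw2m
  have hU2p := hne hw2p
  have hU1m := hne hw1m
  have hU1p := hne hw1p
  have hU1m' : IsUnit ((((c - 1) • ((γH.2.val : GL (Fin 1) (LocalRing L v)).val : Matrix (Fin 1) (Fin 1) (LocalRing L v)) + (c + 1) • (1 : Matrix (Fin 1) (Fin 1) (LocalRing L v))).det)) :=
    hne (z := -1) (by rw [hdet1]; exact hum)
  have hU1p' : IsUnit ((((c + 1) • ((γH.2.val : GL (Fin 1) (LocalRing L v)).val : Matrix (Fin 1) (Fin 1) (LocalRing L v)) + (c - 1) • (1 : Matrix (Fin 1) (Fin 1) (LocalRing L v))).det)) :=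
    hne (z := -1) (by rw [hdet1]; exact hup)
  refine ⟨hw2m, hw2p, hw1m, hw1p, hU2m, hU2p, hU1m, hU1p, hU1m', hU1p', ?_⟩
  -- the `3 × 3` denominator of `ι(γ_H)`: block diagonal
  have e3 : (c - 1) • (((endoEmbLocal L v γH).val : GL (Fin 3) (LocalRing L v)).val : Matrix (Fin 3) (Fin 3) (LocalRing L v)) + (c + 1) • (1 : Matrix (Fin 3) (Fin 3) (LocalRing L v)) =
      Matrix.reindex endoPerm endoPerm (Matrix.fromBlocks
        ((c - 1) • ((γH.1.val : GL (Fin 2) (LocalRing L v)).val : Matrix (Fin 2) (Fin 2) (LocalRing L v)) + (c + 1) • (1 : Matrix (Fin 2) (Fin 2) (LocalRing L v))) 0 0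
        ((c - 1) • ((γH.2.val : GL (Fin 1) (LocalRing L v)).val : Matrix (Fin 1) (Fin 1) (LocalRing L v)) + (c + 1) • (1 : Matrix (Fin 1) (Fin 1) (LocalRing L v)))) := by
    rw [coe_endoEmbLocal, coe_endoGL, smul_reindex_add_smul_one, smul_fromBlocks_add_smul_one]
  rw [e3, Matrix.det_reindex_self, Matrix.det_fromBlocks_zero₁₂]
  exact hU2m.mul hU1m'

/-! ## §3 Type (1): the shifted roots at depth `N − 1`, the value `|χ_{g′}(u′)|_w`, and `G`-regularity of the shift -/

include hw in
set_option maxHeartbeats 800000 in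
-- the carriers' types are large
/-- **THE SHIFTED BINDERS, TYPE (1)**: for a deep `γ_H = (g, u)` (`g_w ≡ 1`, `u_w ≡ 1 (mod c_w)` entrywise) whose `χ_{g_w}` has the two roots `α ≠ γ` with `|α − γ| = exp(−N)`,
`N ≥ 2`, `|α − 1|, |γ − 1| ≤ exp(−2)`, with `|χ_g(u)|_w = exp(−n)`, `n ≥ 2`, and any `γ_H′` on the carriers with `g′ = φ_c(g)`, `u′ = φ_c(u)` as matrices: `χ_{g′_w}` has the
roots `α′ = φ_{c_w}(α)`, `γ′ = φ_{c_w}(γ)`, `α′ ≠ γ′`, `|α′ − γ′| = exp(−(N−1))`, `|α′ − 1| < 1`, `|γ′ − 1| < 1`, `|χ_{g′}(u′)|_w = exp(−(n−2))`, and `γ_H′` is `G`-regular —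
the binders of ★ `stableOrbitalIntegralRel_chi_shift_of_isRoot` and of ★ (A3) at `u_H = γ_H′` (★ α `eval_charpoly_moebius_fin_two`, `disc_moebius_fin_two`; ★ γ₁
`valued_eval_charpoly_moebius`, `separable_charpoly_mul_X_sub_C`; ★ γ₃ `separable_of_map_evalRingHom`). [cite: Rogawski1990, §4.9 Prop. 4.9.1 (a)(b) p. 55; §4.3 p. 42]
[cite: Kottwitz1986, §3] [cite: Flicker1998UnitaryFL, §6] -/
theorem shifted_binders_of_typeOne
    (γH γH' : (cmDatum L 2 (Matrix.of fun i j : Fin 2 => if i.val + j.val + 1 = 2 then (1 : L) else 0)).Local v ×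
      (cmDatum L 1 (Matrix.of fun i j : Fin 1 => if i.val + j.val + 1 = 1 then (1 : L) else 0)).Local v)
    {c : LocalRing L v} (hσc : conjLocal L (IsCMField.complexConj L) v c = c) (hc : Valued.v (c w) = WithZero.exp (-1 : ℤ))
    (h2 : Valued.v (2 : w.1.adicCompletion L) = 1)
    (h1 : ((γH'.1.val : GL (Fin 2) (LocalRing L v)).val : Matrix (Fin 2) (Fin 2) (LocalRing L v)) =
      ((c + 1) • ((γH.1.val : GL (Fin 2) (LocalRing L v)).val : Matrix (Fin 2) (Fin 2) (LocalRing L v)) + (c - 1) • 1) *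
        ((c - 1) • ((γH.1.val : GL (Fin 2) (LocalRing L v)).val : Matrix (Fin 2) (Fin 2) (LocalRing L v)) + (c + 1) • 1)⁻¹)
    (hu' : finGammaTwo L v γH' = ((c + 1) * finGammaTwo L v γH + (c - 1)) * Ring.inverse ((c - 1) * finGammaTwo L v γH + (c + 1)))
    (hg1 : ∀ i j, Valued.v ((((γH.1.val : GL (Fin 2) (LocalRing L v)).val.map (Pi.evalRingHom (fun w' : PlacesOver L v => w'.1.adicCompletion L) w)) - 1) i j) ≤ Valued.v (c w))
    (hu1 : Valued.v (finGammaTwo L v γH w - 1) ≤ Valued.v (c w))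
    (α γ : w.1.adicCompletion L)
    (hα : ((((γH.1.val : GL (Fin 2) (LocalRing L v)) : Matrix (Fin 2) (Fin 2) (LocalRing L v)).charpoly).map (Pi.evalRingHom (fun w' : PlacesOver L v => w'.1.adicCompletion L) w)).IsRoot α)
    (hγ : ((((γH.1.val : GL (Fin 2) (LocalRing L v)) : Matrix (Fin 2) (Fin 2) (LocalRing L v)).charpoly).map (Pi.evalRingHom (fun w' : PlacesOver L v => w'.1.adicCompletion L) w)).IsRoot γ)
    (hαγ : α ≠ γ) (N : ℕ) (hN : Valued.v (α - γ) = WithZero.exp (-(N : ℤ))) (h2N : 2 ≤ N)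
    (hα2 : Valued.v (α - 1) ≤ WithZero.exp (-2 : ℤ)) (hγ2 : Valued.v (γ - 1) ≤ WithZero.exp (-2 : ℤ))
    {n : ℕ} (hn2 : 2 ≤ n)
    (hn : Valued.v (((finCharpolyTwo L v γH).eval (finGammaTwo L v γH)) w) = WithZero.exp (-(n : ℤ))) :
    ((((γH'.1.val : GL (Fin 2) (LocalRing L v)) : Matrix (Fin 2) (Fin 2) (LocalRing L v)).charpoly).map (Pi.evalRingHom (fun w' : PlacesOver L v => w'.1.adicCompletion L) w)).IsRoot
        (((c w + 1) * α + (c w - 1)) / ((c w - 1) * α + (c w + 1))) ∧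
    ((((γH'.1.val : GL (Fin 2) (LocalRing L v)) : Matrix (Fin 2) (Fin 2) (LocalRing L v)).charpoly).map (Pi.evalRingHom (fun w' : PlacesOver L v => w'.1.adicCompletion L) w)).IsRoot
        (((c w + 1) * γ + (c w - 1)) / ((c w - 1) * γ + (c w + 1))) ∧
    ((c w + 1) * α + (c w - 1)) / ((c w - 1) * α + (c w + 1)) ≠ ((c w + 1) * γ + (c w - 1)) / ((c w - 1) * γ + (c w + 1)) ∧
    Valued.v (((c w + 1) * α + (c w - 1)) / ((c w - 1) * α + (c w + 1)) - ((c w + 1) * γ + (c w - 1)) / ((c w - 1) * γ + (c w + 1))) =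
      WithZero.exp (-((N - 1 : ℕ) : ℤ)) ∧
    Valued.v (((c w + 1) * α + (c w - 1)) / ((c w - 1) * α + (c w + 1)) - 1) < 1 ∧
    Valued.v (((c w + 1) * γ + (c w - 1)) / ((c w - 1) * γ + (c w + 1)) - 1) < 1 ∧
    Valued.v (((finCharpolyTwo L v γH').eval (finGammaTwo L v γH')) w) = WithZero.exp (-((n - 2 : ℕ) : ℤ)) ∧
    IsLocalGRegular L v γH' := by
  have hv : Subsingleton (PlacesOver L v) := PlacesOver.subsingleton_of_smul_eq (IsCMField.complexConj L) (IsCMField.complexConj_ne_one L) w hw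
  set evw : LocalRing L v →+* w.1.adicCompletion L := Pi.evalRingHom (fun w' : PlacesOver L v => w'.1.adicCompletion L) w with hevw
  set gw : Matrix (Fin 2) (Fin 2) (w.1.adicCompletion L) := ((γH.1.val : GL (Fin 2) (LocalRing L v)).val.map evw) with hgw
  set uw : w.1.adicCompletion L := finGammaTwo L v γH w with huw
  set cw : w.1.adicCompletion L := c w with hcw
  obtain ⟨hc0, -, -, -, -, -⟩ := shift_parameter_facts hc
  haveI : NeZero (2 : w.1.adicCompletion L) := ⟨fun h => by rw [h, map_zero] at h2; exact zero_ne_one h2⟩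
  -- the characteristic polynomial at `w` and its discriminant `(α − γ)²`
  have hchar : (((γH.1.val : GL (Fin 2) (LocalRing L v)) : Matrix (Fin 2) (Fin 2) (LocalRing L v)).charpoly).map evw = gw.charpoly := by
    rw [hgw, Matrix.charpoly_map]
  rw [hchar] at hα hγ
  obtain ⟨-, -, hdiscg⟩ := trace_det_disc_of_isRoot_of_isRoot gw hα hγ hαγ
  have hdiscv : Valued.v (gw.trace ^ 2 - 4 * gw.det) = WithZero.exp (-((2 * N : ℕ) : ℤ)) := by
    rw [hdiscg, map_pow, hN, ← WithZero.exp_nsmul]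
    congr 1
    simp only [smul_neg, nsmul_eq_mul, Nat.cast_ofNat, Nat.cast_mul]
  have hdisc : Valued.v (gw.trace ^ 2 - 4 * gw.det) < WithZero.exp (-2 : ℤ) := by
    rw [hdiscv, WithZero.exp_lt_exp]; omega
  obtain ⟨hw2m, -, hw1m, -, hU2m, -, hU1m, -, -, -, -⟩ := isUnit_shift_denominators_of_disc_lt L v w hw γH hσc hc h2 hg1 hu1 hdisc
  -- `g′_w = φ_{c_w}(g_w)` and `u′_w = φ_{c_w}(u_w)`
  have hg'w : ((γH'.1.val : GL (Fin 2) (LocalRing L v)).val.map evw) =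
      ((cw + 1) • gw + (cw - 1) • (1 : Matrix (Fin 2) (Fin 2) (w.1.adicCompletion L))) * ((cw - 1) • gw + (cw + 1) • (1 : Matrix (Fin 2) (Fin 2) (w.1.adicCompletion L)))⁻¹ := by
    rw [h1, map_moebius evw _ _ _ hU2m, map_add, map_sub, map_one]
    rfl
  have hD2w : Valued.v (((cw - 1) • gw + (cw + 1) • (1 : Matrix (Fin 2) (Fin 2) (w.1.adicCompletion L))).det) = WithZero.exp (-2 : ℤ) := by
    have e1 : (((c - 1) • ((γH.1.val : GL (Fin 2) (LocalRing L v)).val : Matrix (Fin 2) (Fin 2) (LocalRing L v)) + (c + 1) • (1 : Matrix (Fin 2) (Fin 2) (LocalRing L v))).det) w =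
        evw (((c - 1) • ((γH.1.val : GL (Fin 2) (LocalRing L v)).val : Matrix (Fin 2) (Fin 2) (LocalRing L v)) + (c + 1) • (1 : Matrix (Fin 2) (Fin 2) (LocalRing L v))).det) := rfl
    have e : (((c - 1) • ((γH.1.val : GL (Fin 2) (LocalRing L v)).val : Matrix (Fin 2) (Fin 2) (LocalRing L v)) + (c + 1) • (1 : Matrix (Fin 2) (Fin 2) (LocalRing L v))).det) w =
        (((cw - 1) • gw + (cw + 1) • (1 : Matrix (Fin 2) (Fin 2) (w.1.adicCompletion L))).det) := by
      rw [e1, RingHom.map_det, RingHom.mapMatrix_apply, map_smul_add_smul_one, map_sub, map_add, map_one]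
      rfl
    rw [← e]; exact hw2m
  have hD0 : ((cw - 1) • gw + (cw + 1) • (1 : Matrix (Fin 2) (Fin 2) (w.1.adicCompletion L))).det ≠ 0 := fun h => by
    rw [h, map_zero] at hD2w; exact WithZero.zero_ne_coe hD2w
  have huw' : finGammaTwo L v γH' w = ((cw + 1) * uw + (cw - 1)) / ((cw - 1) * uw + (cw + 1)) := by
    have hmul : finGammaTwo L v γH' * ((c - 1) * finGammaTwo L v γH + (c + 1)) = (c + 1) * finGammaTwo L v γH + (c - 1) := by
      rw [hu', mul_assoc, Ring.inverse_mul_cancel _ hU1m, mul_one]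
    have hmw := congrFun hmul w
    simp only [Pi.mul_apply, Pi.add_apply, Pi.sub_apply, Pi.one_apply] at hmw
    have hne : (cw - 1) * uw + (cw + 1) ≠ 0 := fun h => by
      have e : ((c - 1) * finGammaTwo L v γH + (c + 1)) w = (cw - 1) * uw + (cw + 1) := rfl
      rw [e, h, map_zero] at hw1m; exact WithZero.zero_ne_coe hw1m
    rw [eq_div_iff hne]
    exact hmw
  -- (1)(2) the shifted roots
  obtain ⟨hDα, -⟩ := valued_shift_denominators_of_deep h2 hc hα2
  obtain ⟨hDγ, -⟩ := valued_shift_denominators_of_deep h2 hc hγ2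
  have hDα0 : (cw - 1) * α + (cw + 1) ≠ 0 := fun h => by rw [h, map_zero] at hDα; exact WithZero.zero_ne_coe hDα
  have hDγ0 : (cw - 1) * γ + (cw + 1) ≠ 0 := fun h => by rw [h, map_zero] at hDγ; exact WithZero.zero_ne_coe hDγ
  have hchar' : (((γH'.1.val : GL (Fin 2) (LocalRing L v)) : Matrix (Fin 2) (Fin 2) (LocalRing L v)).charpoly).map evw =
      (((cw + 1) • gw + (cw - 1) • (1 : Matrix (Fin 2) (Fin 2) (w.1.adicCompletion L))) * ((cw - 1) • gw + (cw + 1) • (1 : Matrix (Fin 2) (Fin 2) (w.1.adicCompletion L)))⁻¹).charpoly := by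
    rw [← Matrix.charpoly_map, ← hg'w]
  have hrootα := isRoot_charpoly_moebius_of_isRoot gw (cw + 1) (cw - 1) α hD0 hDα0 hα
  have hrootγ := isRoot_charpoly_moebius_of_isRoot gw (cw + 1) (cw - 1) γ hD0 hDγ0 hγ
  -- (4) the depth `N − 1`
  have hN' : Valued.v (((cw + 1) * α + (cw - 1)) / ((cw - 1) * α + (cw + 1)) - ((cw + 1) * γ + (cw - 1)) / ((cw - 1) * γ + (cw + 1))) =
      WithZero.exp (-((N - 1 : ℕ) : ℤ)) := by
    rw [valued_moebius_scalar_sub h2 hc hα2 hγ2, hN, ← WithZero.exp_add]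
    congr 1
    omega
  -- (3) distinct
  have hne' : ((cw + 1) * α + (cw - 1)) / ((cw - 1) * α + (cw + 1)) ≠ ((cw + 1) * γ + (cw - 1)) / ((cw - 1) * γ + (cw + 1)) := fun h => by
    rw [← sub_eq_zero] at h
    rw [h, map_zero] at hN'
    exact WithZero.zero_ne_coe hN'
  -- (7) the value `χ_{g′}(u′)`
  have hev : ∀ (γ : (cmDatum L 2 (Matrix.of fun i j : Fin 2 => if i.val + j.val + 1 = 2 then (1 : L) else 0)).Local v ×
      (cmDatum L 1 (Matrix.of fun i j : Fin 1 => if i.val + j.val + 1 = 1 then (1 : L) else 0)).Local v),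
      ((finCharpolyTwo L v γ).eval (finGammaTwo L v γ)) w = (((γ.1.val : GL (Fin 2) (LocalRing L v)).val.map evw).charpoly).eval (finGammaTwo L v γ w) := fun γ => by
    have e : ((finCharpolyTwo L v γ).eval (finGammaTwo L v γ)) w = evw ((finCharpolyTwo L v γ).eval (finGammaTwo L v γ)) := rfl
    rw [e, ← Polynomial.eval₂_at_apply, ← Polynomial.eval_map, finCharpolyTwo, ← Matrix.charpoly_map]
    rfl
  have hnw : Valued.v (gw.charpoly.eval uw) = WithZero.exp (-(n : ℤ)) := by rw [hgw, huw, ← hev]; exact hn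
  have hw1m' : Valued.v ((cw - 1) * uw + (cw + 1)) = WithZero.exp (-1 : ℤ) := hw1m
  have hn' := valued_eval_charpoly_moebius h2 hc gw uw hD2w hw1m' hn2 hnw
  rw [← hg'w, ← huw'] at hn'
  rw [← hev] at hn'
  -- (8) `G`-regularity: separability at `w`, lifted to `E_v`
  have h4c : (cw + 1) ^ 2 - (cw - 1) ^ 2 ≠ 0 := by
    rw [show (cw + 1) ^ 2 - (cw - 1) ^ 2 = 2 * 2 * cw by ring]
    exact mul_ne_zero (mul_ne_zero (NeZero.ne 2) (NeZero.ne 2)) hc0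
  have hdiscg0 : gw.trace ^ 2 - 4 * gw.det ≠ 0 := fun h => by
    rw [h, map_zero] at hdiscv; exact WithZero.zero_ne_coe hdiscv
  have hdisc' : ((γH'.1.val : GL (Fin 2) (LocalRing L v)).val.map evw).trace ^ 2 - 4 * ((γH'.1.val : GL (Fin 2) (LocalRing L v)).val.map evw).det ≠ 0 := fun h => by
    have key := disc_moebius_fin_two gw (cw + 1) (cw - 1) hD0
    rw [← hg'w, h, zero_mul] at key
    exact (mul_ne_zero (pow_ne_zero 2 h4c) hdiscg0) key.symm
  have hval' : (((γH'.1.val : GL (Fin 2) (LocalRing L v)).val.map evw).charpoly).eval (finGammaTwo L v γH' w) ≠ 0 := fun h => by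
    rw [hev, h, map_zero] at hn'; exact WithZero.zero_ne_coe hn'
  have hsepw := separable_charpoly_mul_X_sub_C _ _ hdisc' hval'
  have hreg' : IsLocalGRegular L v γH' := by
    have hgoal : (((γH'.1.val : GL (Fin 2) (LocalRing L v)).val : Matrix (Fin 2) (Fin 2) (LocalRing L v)).charpoly *
        ((γH'.2.val : GL (Fin 1) (LocalRing L v)).val : Matrix (Fin 1) (Fin 1) (LocalRing L v)).charpoly).Separable := by
      refine separable_of_map_evalRingHom L v w hv _ ?_
      rw [Polynomial.map_mul, ← Matrix.charpoly_map, ← Matrix.charpoly_map]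
      have hUc : (((γH'.2.val : GL (Fin 1) (LocalRing L v)).val : Matrix (Fin 1) (Fin 1) (LocalRing L v)).map evw).charpoly = X - C (finGammaTwo L v γH' w) := by
        rw [Matrix.charpoly, Matrix.det_fin_one, Matrix.charmatrix_apply_eq, Matrix.map_apply]
        rfl
      rw [hUc]
      exact hsepw
    simp only [IsLocalGRegular, IsGRegular, IsRegularElt, coe_endoEmb, coe_endoGL, Matrix.charpoly_reindex, Matrix.charpoly_fromBlocks_zero₁₂]
    exact hgoal
  refine ⟨?_, ?_, hne', hN', valued_moebius_scalar_sub_one_lt_one h2 hc hα2, valued_moebius_scalar_sub_one_lt_one h2 hc hγ2, hn', hreg'⟩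
  · rw [hchar']; exact hrootα
  · rw [hchar']; exact hrootγ

/-! ## §4 «Non-Levi is preserved by the shift» -/

/-- A diagonal avatar: `x • diagonal d + y • 1 = diagonal (x·d + y)` (`2 × 2`). [cite: HornJohnson2013, §0.9.1] -/
theorem smul_diagonal_add_smul_one_fin_two {R : Type*} [CommRing R] (d : Fin 2 → R) (x y : R) :
    x • Matrix.diagonal d + y • (1 : Matrix (Fin 2) (Fin 2) R) = Matrix.diagonal (fun k => x * d k + y) := by
  refine Matrix.ext fun i j => ?_
  by_cases hij : i = j
  · subst hij; simp [Matrix.diagonal_apply_eq, Matrix.one_apply_eq]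
  · simp [Matrix.diagonal_apply_ne _ hij, Matrix.one_apply_ne hij]

/-- **NON-LEVI IS PRESERVED BY THE CAYLEY SHIFT**: if `γ_H′ = (φ_c g, ·)` on matrices (`4c = (c+1)² − (c−1)²` and `det((c−1)g + (c+1))` units) and `γ_H.1` is NOT
`H_v`-conjugate to a diagonal torus element, then neither is `γ_H′.1` — for `y γ_H′.1 y⁻¹ = diag(d′)` gives `y γ_H.1 y⁻¹ = ψ(diag d′)` (`ψ = φ_{c+1,−(c−1)}` undoes `φ_c`, ★
`moebius_neg_moebius`, and commutes with conjugation, ★ α `moebius_conj`), a diagonal matrix with unit entries. This is the `hell ↦ hell′` binder of ★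
`stableOrbitalIntegralRel_chi_shift_of_isRoot` ∕ `…_of_not_exists_isRoot`. [cite: Rogawski1990, §4.9 Prop. 4.9.1 (a) p. 55] [cite: Kottwitz1986, §3] -/
theorem not_levi_of_shift
    (γH γH' : (cmDatum L 2 (Matrix.of fun i j : Fin 2 => if i.val + j.val + 1 = 2 then (1 : L) else 0)).Local v ×
      (cmDatum L 1 (Matrix.of fun i j : Fin 1 => if i.val + j.val + 1 = 1 then (1 : L) else 0)).Local v)
    {c : LocalRing L v} (h4c : IsUnit ((c + 1) ^ 2 - (c - 1) ^ 2))
    (h1 : ((γH'.1.val : GL (Fin 2) (LocalRing L v)).val : Matrix (Fin 2) (Fin 2) (LocalRing L v)) =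
      ((c + 1) • ((γH.1.val : GL (Fin 2) (LocalRing L v)).val : Matrix (Fin 2) (Fin 2) (LocalRing L v)) + (c - 1) • 1) *
        ((c - 1) • ((γH.1.val : GL (Fin 2) (LocalRing L v)).val : Matrix (Fin 2) (Fin 2) (LocalRing L v)) + (c + 1) • 1)⁻¹)
    (hD1 : IsUnit ((c - 1) • ((γH.1.val : GL (Fin 2) (LocalRing L v)).val : Matrix (Fin 2) (Fin 2) (LocalRing L v)) + (c + 1) • (1 : Matrix (Fin 2) (Fin 2) (LocalRing L v))).det)
    (hell : ¬ ∃ (y : ((cmDatum L 2 (Matrix.of fun i j : Fin 2 => if i.val + j.val + 1 = 2 then (1 : L) else 0)).Local v ×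
        (cmDatum L 1 (Matrix.of fun i j : Fin 1 => if i.val + j.val + 1 = 1 then (1 : L) else 0)).Local v)) (d' : Fin 2 → (UnitaryGroup.LocalRing L v)ˣ),
        glDiagonal 2 (UnitaryGroup.LocalRing L v) d' = ((y * γH * y⁻¹).1.val : GL (Fin 2) (UnitaryGroup.LocalRing L v))) :
    ¬ ∃ (y : ((cmDatum L 2 (Matrix.of fun i j : Fin 2 => if i.val + j.val + 1 = 2 then (1 : L) else 0)).Local v ×
        (cmDatum L 1 (Matrix.of fun i j : Fin 1 => if i.val + j.val + 1 = 1 then (1 : L) else 0)).Local v)) (d' : Fin 2 → (UnitaryGroup.LocalRing L v)ˣ),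
        glDiagonal 2 (UnitaryGroup.LocalRing L v) d' = ((y * γH' * y⁻¹).1.val : GL (Fin 2) (UnitaryGroup.LocalRing L v)) := by
  rintro ⟨y, d', hd⟩
  apply hell
  -- abbreviations
  set G : Matrix (Fin 2) (Fin 2) (LocalRing L v) := ((γH.1.val : GL (Fin 2) (LocalRing L v)).val : Matrix (Fin 2) (Fin 2) (LocalRing L v)) with hG
  set Y : Matrix (Fin 2) (Fin 2) (LocalRing L v) := ((y.1.val : GL (Fin 2) (LocalRing L v)).val : Matrix (Fin 2) (Fin 2) (LocalRing L v)) with hY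
  have hYdet : IsUnit Y.det := Matrix.isUnits_det_units _
  have hGdet : IsUnit G.det := Matrix.isUnits_det_units _
  have hψD : IsUnit (((-(c - 1)) • (((c + 1) • G + (c - 1) • 1) * ((c - 1) • G + (c + 1) • 1)⁻¹) + (c + 1) • (1 : Matrix (Fin 2) (Fin 2) (LocalRing L v))).det) :=
    isUnit_det_neg_smul_moebius_add_smul_one G h4c hD1
  -- the matrices of the two conjugates
  have hcoe' : (y * γH' * y⁻¹).1.val = y.1.val * γH'.1.val * y.1.val⁻¹ := rfl
  have hcoe : (y * γH * y⁻¹).1.val = y.1.val * γH.1.val * y.1.val⁻¹ := rfl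
  have hd' : Matrix.diagonal (fun k => (d' k : LocalRing L v)) = Y * (((c + 1) • G + (c - 1) • 1) * ((c - 1) • G + (c + 1) • 1)⁻¹) * Y⁻¹ := by
    have h := congrArg (fun g : GL (Fin 2) (LocalRing L v) => g.val) hd
    rw [coe_glDiagonal, hcoe', Units.val_mul, Units.val_mul, Matrix.coe_units_inv, h1] at h
    exact h
  -- `Y G Y⁻¹ = ψ(diag d′)`
  have key : Y * G * Y⁻¹ =
      ((c + 1) • Matrix.diagonal (fun k => (d' k : LocalRing L v)) + (-(c - 1)) • (1 : Matrix (Fin 2) (Fin 2) (LocalRing L v))) *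
        ((-(c - 1)) • Matrix.diagonal (fun k => (d' k : LocalRing L v)) + (c + 1) • (1 : Matrix (Fin 2) (Fin 2) (LocalRing L v)))⁻¹ := by
    rw [hd', moebius_conj _ _ hYdet _ _ hψD, moebius_neg_moebius G h4c hD1]
  -- the `ψ`-denominator at `diag d′` is diagonal with unit entries
  have hDd : IsUnit (((-(c - 1)) • Matrix.diagonal (fun k => (d' k : LocalRing L v)) + (c + 1) • (1 : Matrix (Fin 2) (Fin 2) (LocalRing L v))).det) := by
    rw [hd', det_smul_conj_add_smul_one _ _ hYdet]; exact hψD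
  rw [smul_diagonal_add_smul_one_fin_two, smul_diagonal_add_smul_one_fin_two] at key
  rw [smul_diagonal_add_smul_one_fin_two, Matrix.det_diagonal, Fin.prod_univ_two] at hDd
  have hDu : ∀ k : Fin 2, IsUnit (-(c - 1) * (d' k : LocalRing L v) + (c + 1)) :=
    Fin.forall_fin_two.2 ⟨isUnit_of_mul_isUnit_left hDd, isUnit_of_mul_isUnit_right hDd⟩
  have hinv : (Matrix.diagonal (fun k => -(c - 1) * (d' k : LocalRing L v) + (c + 1)))⁻¹ =
      Matrix.diagonal (fun k => (((hDu k).unit⁻¹ : (LocalRing L v)ˣ) : LocalRing L v)) := by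
    refine Matrix.inv_eq_left_inv ?_
    rw [Matrix.diagonal_mul_diagonal, ← Matrix.diagonal_one]
    congr 1
    funext k
    exact (hDu k).val_inv_mul
  rw [hinv, Matrix.diagonal_mul_diagonal] at key
  -- the entries of the diagonal `Y G Y⁻¹` are units
  have hedet : IsUnit (Matrix.diagonal (fun k => ((c + 1) * (d' k : LocalRing L v) + -(c - 1)) * (((hDu k).unit⁻¹ : (LocalRing L v)ˣ) : LocalRing L v))).det := by
    rw [← key, Matrix.det_conj ((Matrix.isUnit_iff_isUnit_det Y).2 hYdet)]; exact hGdet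
  rw [Matrix.det_diagonal, Fin.prod_univ_two] at hedet
  have heu : ∀ k : Fin 2, IsUnit (((c + 1) * (d' k : LocalRing L v) + -(c - 1)) * (((hDu k).unit⁻¹ : (LocalRing L v)ˣ) : LocalRing L v)) :=
    Fin.forall_fin_two.2 ⟨isUnit_of_mul_isUnit_left hedet, isUnit_of_mul_isUnit_right hedet⟩
  refine ⟨y, fun k => (heu k).unit, Units.ext ?_⟩
  rw [coe_glDiagonal, hcoe, Units.val_mul, Units.val_mul, Matrix.coe_units_inv]
  change Matrix.diagonal (fun k => (((heu k).unit : (LocalRing L v)ˣ) : LocalRing L v)) = Y * G * Y⁻¹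
  rw [key]
  congr 1

end Literature.NumberTheory.Rogawski1990

end
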